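import Summits.AtomisticToContinuum.BoseEinsteinCondensation.Theorems.BECGroundStateSOSPeriodicIRBoundDefs
import Summits.AtomisticToContinuum.BoseEinsteinCondensation.Theorems.PeriodicIRBound.Negative.AeZeroPotential
import Summits.AtomisticToContinuum.BoseEinsteinCondensation.Theorems.BECConjugateDominationHardCoreExtensionBoundedPositiveMinimiser
import Literature.MathematicalPhysics.QuantumManyBody.PeriodicGroundStateNondegenerateProofs
import Literature.MathematicalPhysics.QuantumManyBody.PeriodicTorusByParts
import Literature.MathematicalPhysics.QuantumManyBody.WeightedCorrector
import HarnessLib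

/-!
# Crux `PeriodicIRBound` (stmt-AtomisticToContinuum-3972), line `linear-ph-floor-wagner` —
# stub 3a: the fixed-`(N, L)` zero-momentum gap for BOUNDED admissible potentials

Helper file of the line lead (seat c1) for the crux skeleton
`Cruxes/PeriodicIRBound/Lines/linear_ph_floor_wagner.lean`. The skeleton's pooled stub 3
(`stub_zeroMomentumGround` = stmt-AtomisticToContinuum-11845, `BECNoCheapMomentum.ZeroMomentumGround`) asks
for the zero-momentum gap `E₀^per(N,L) < E^per_N(q;L)` (`q ≠ 0`) of every INTEGRABLE admissible pair
potential, at every `(N, L)`. This file proves it for every admissible potential that is BOUNDED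
(`v ≤ M < ⊤`; then `v ∈ L¹` automatically), at every `N` and every `L > 0`
(`zeroMomentumGapFor_of_bounded`), from the tree's nondegeneracy theorem
`Literature.MathematicalPhysics.QuantumManyBody.PeriodicGroundStateNondegenerate_holds`
(Reed–Simon IV §XIII.12 on the torus: `2·E₀^per(N,L) < kyFanTwo v N L` for `N ≥ 1`, `L > 0`, bounded
periodisation) by the following elementary argument:

* a `C¹` torus-periodic function of non-zero total momentum has zero mean over the fundamental cell
  (`integral_cellN_eq_zero_of_hasTotalMomentum`: `∑ⱼ ∂_{j,a} G = i k_a G` pointwise,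
  `HasTotalMomentum.sum_fderiv_apply_single`, and `∫ ∂G = 0` by periodic integration by parts,
  `integral_cellN_fderiv_apply_eq_zero`);
* hence a Bloch-`q` state `Ψ` (`q ≠ 0`) is orthogonal on the cell to its complex conjugate `Ψ.conj`
  (Bloch `-q`; `∫ conj(Ψ)·conj(Ψ) = conj ∫ Ψ² = 0` since `Ψ²` has momentum `2q ≠ 0`), and the two have the
  same energy (`periodicEnergy_conj`), so `kyFanTwo v N L ≤ 2⟨Ψ, HΨ⟩`
  (`kyFanTwo_le_two_mul_periodicEnergy_of_hasTotalMomentum`);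
* therefore `E₀^per < kyFanTwo/2 ≤ E^per_N(q;L)` for `N ≥ 1`
  (`zeroMomentumGap_of_periodizedPotential_le`); for `N = 0` the sector `q ≠ 0` is empty
  (`momentumSectorEnergy_zero_particles`) while `E₀^per(0,L) = 0`.

The UNBOUNDED integrable potentials of stmt-11845 are not covered: the tree's Feynman–Kac /
Perron–Frobenius package (`PeriodicFeynmanKac*`, `PeriodicGroundStateFeynmanKacProofs`) is developed for
bounded periodisations only (skeleton stub 3b).

References: M. Reed, B. Simon, *Methods of Modern Mathematical Physics IV* (1978) §XIII.12;
H. D. Cornean, J. Dereziński, P. Ziń, J. Math. Phys. 50 (2009) 062103, §2.7 ("the ground state of `H`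
is nondegenerate", `ε(0) = 0`).
-/

noncomputable section

open scoped BigOperators ENNReal ComplexConjugate
open Filter MeasureTheory

namespace Summit.AtomisticToContinuum.BoseEinsteinCondensation.Cruxes.PeriodicIRBound.LinearPhFloorWagner

open Literature.MathematicalPhysics.QuantumManyBody
open Literature.MathematicalPhysics.QuantumManyBody.BoseGas
open Summit.AtomisticToContinuum.BoseEinsteinCondensation.Theorems.PeriodicIRBound.Negative
  (momentumSectorEnergy_zero_particles)
open Summit.AtomisticToContinuum.BoseEinsteinCondensation.Cruxes.HardCoreExtension.ThirdLawCurrentFloor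
  (exists_periodizedPotential_le)

variable {N : ℕ} {L : ℝ}

/-! ## §1 Non-zero total momentum ⇒ zero mean over the cell -/

/-- A non-zero vector of `ℝ³` has a non-zero coordinate. [folklore] -/
theorem exists_apply_ne_zero_of_ne_zero {k : Space} (hk : k ≠ 0) : ∃ a : Fin 3, k a ≠ 0 := by
  by_contra h
  push Not at h
  exact hk (PiLp.ext fun a => by simpa using h a)

/-- **A `C¹` torus-periodic function of non-zero total momentum has zero mean over the fundamental
cell.** Differentiate the Bloch condition along the diagonal direction `eₐ` (`∑ⱼ ∂_{j,a} G = i kₐ G`,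
`HasTotalMomentum.sum_fderiv_apply_single`) and integrate over `[0,L)^{3N}`: the left side vanishes by
periodic integration by parts, so `i kₐ ∫G = 0`; choose `a` with `kₐ ≠ 0`. [folklore] -/
theorem integral_cellN_eq_zero_of_hasTotalMomentum (hL : 0 < L) {G : Config N → ℂ}
    (hG : ContDiff ℝ 1 G)
    (hper : ∀ (X : Config N) (i : Fin N) (c : Fin 3),
      G (X + Pi.single i (EuclideanSpace.single c L)) = G X)
    {k : Space} (hk : HasTotalMomentum k G) (hk0 : k ≠ 0) :
    ∫ X in cellN N L, G X = 0 := by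
  obtain ⟨a, ha⟩ := exists_apply_ne_zero_of_ne_zero hk0
  have hGd : Differentiable ℝ G := hG.differentiable one_ne_zero
  -- `∫ ∑ⱼ ∂_{j,a} G = 0`
  have hsum : ∫ X in cellN N L,
      ∑ i : Fin N, fderiv ℝ G X (Pi.single i (EuclideanSpace.single a (1 : ℝ))) = 0 := by
    rw [integral_finsetSum _ fun i _ =>
      integrableOn_cellN (continuous_fderiv_apply_const hG _) L]
    exact Finset.sum_eq_zero fun i _ => integral_cellN_fderiv_apply_eq_zero hL hG hper _
  -- `∑ⱼ ∂_{j,a} G = i kₐ G`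
  have hpt : ∀ X, ∑ i : Fin N, fderiv ℝ G X (Pi.single i (EuclideanSpace.single a (1 : ℝ))) =
      ((k a : ℂ) * Complex.I) * G X := fun X => hk.sum_fderiv_apply_single hGd X a
  simp_rw [hpt] at hsum
  rw [integral_const_mul, mul_eq_zero] at hsum
  refine hsum.resolve_left ?_
  exact mul_ne_zero (Complex.ofReal_ne_zero.2 ha) Complex.I_ne_zero

/-- **A Bloch-`q` state with `q ≠ 0` is orthogonal on the cell to its complex conjugate**:
`∫_{[0,L)^{3N}} conj(Ψ)·conj(Ψ) = conj ∫ Ψ² = 0`, because `Ψ²` has total momentum `2q ≠ 0`.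
This is the orthogonality relation entering `kyFanTwo`. [folklore] -/
theorem integral_cellN_conj_mul_conj_eq_zero (hL : 0 < L) (Ψ : PeriodicTrialState N L) {q : Space}
    (hΨ : HasTotalMomentum q Ψ.ψ) (hq : q ≠ 0) :
    ∫ X in cellN N L, conj (Ψ.ψ X) * Ψ.conj.ψ X = 0 := by
  have h2q : q + q ≠ 0 := by
    rw [← two_smul ℝ q]
    exact smul_ne_zero two_ne_zero hq
  have hsq : ∫ X in cellN N L, Ψ.ψ X * Ψ.ψ X = 0 :=
    integral_cellN_eq_zero_of_hasTotalMomentum hL (Ψ.contDiff.mul Ψ.contDiff)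
      (fun X i c => by rw [Ψ.periodic]) (hΨ.mul hΨ) h2q
  have hfun : (fun X => conj (Ψ.ψ X) * Ψ.conj.ψ X) = fun X => conj (Ψ.ψ X * Ψ.ψ X) := by
    funext X
    rw [PeriodicTrialState.conj_apply, map_mul]
  rw [hfun, integral_conj, hsq, map_zero]

/-! ## §2 Ky Fan two-sum versus the momentum sectors -/

/-- **`kyFanTwo ≤ 2⟨Ψ, HΨ⟩` for every Bloch-`q` state with `q ≠ 0`**: the pair `(Ψ, conj Ψ)` is
admissible in the Ky Fan two-sum (orthogonal on the cell, `integral_cellN_conj_mul_conj_eq_zero`) and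
`⟨conj Ψ, H conj Ψ⟩ = ⟨Ψ, HΨ⟩` (`periodicEnergy_conj`). [folklore] -/
theorem kyFanTwo_le_two_mul_periodicEnergy_of_hasTotalMomentum (hL : 0 < L) (v : ℝ → ℝ≥0∞)
    (Ψ : PeriodicTrialState N L) {q : Space} (hΨ : HasTotalMomentum q Ψ.ψ) (hq : q ≠ 0) :
    kyFanTwo v N L ≤ 2 * periodicEnergy v Ψ := by
  have horth := integral_cellN_conj_mul_conj_eq_zero hL Ψ hΨ hq
  calc kyFanTwo v N L ≤ periodicEnergy v Ψ + periodicEnergy v Ψ.conj :=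
        iInf_le_of_le Ψ (iInf_le_of_le Ψ.conj (iInf_le_of_le horth le_rfl))
    _ = 2 * periodicEnergy v Ψ := by rw [periodicEnergy_conj, two_mul]

/-- **`kyFanTwo/2 ≤ E^per_N(q;L)` for `q ≠ 0`.** [folklore] -/
theorem kyFanTwo_div_two_le_momentumSectorEnergy (hL : 0 < L) (v : ℝ → ℝ≥0∞) (N : ℕ)
    {q : Space} (hq : q ≠ 0) : kyFanTwo v N L / 2 ≤ momentumSectorEnergy v N L q := by
  refine le_momentumSectorEnergy_iff.2 fun Ψ hΨ => ?_
  rw [ENNReal.div_le_iff_le_mul (Or.inl two_ne_zero) (Or.inl ENNReal.ofNat_ne_top), mul_comm]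
  exact kyFanTwo_le_two_mul_periodicEnergy_of_hasTotalMomentum hL v Ψ hΨ hq

/-! ## §3 The zero-momentum gap -/

/-- **Nondegeneracy ⇒ zero-momentum gap.** If `2·E₀^per(N,L) < kyFanTwo v N L` (simple ground state in
Ky Fan form) then `E₀^per(N,L) < E^per_N(q;L)` for every `q ≠ 0`. [folklore] -/
theorem zeroMomentumGap_of_two_mul_lt_kyFanTwo (hL : 0 < L) {v : ℝ → ℝ≥0∞} {N : ℕ}
    (h : 2 * periodicGroundStateEnergy v N L < kyFanTwo v N L) {q : Space} (hq : q ≠ 0) :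
    periodicGroundStateEnergy v N L < momentumSectorEnergy v N L q := by
  refine lt_of_lt_of_le ?_ (kyFanTwo_div_two_le_momentumSectorEnergy hL v N hq)
  rw [ENNReal.lt_div_iff_mul_lt (Or.inl two_ne_zero) (Or.inl ENNReal.ofNat_ne_top), mul_comm]
  exact h

/-- For `N = 0` the periodic energy does not see the potential (there are no pairs). [folklore] -/
theorem periodicEnergy_zero_particles (v : ℝ → ℝ≥0∞) (Ψ : PeriodicTrialState 0 L) :
    periodicEnergy v Ψ = periodicEnergy 0 Ψ := by
  unfold periodicEnergy periodicInteraction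
  simp

/-- `E₀^per(v, 0, L) = 0` for `L > 0` (no particles: no kinetic energy, no pairs). [folklore] -/
theorem periodicGroundStateEnergy_zero_particles (v : ℝ → ℝ≥0∞) (hL : 0 < L) :
    periodicGroundStateEnergy v 0 L = 0 := by
  have h : periodicGroundStateEnergy v 0 L = periodicGroundStateEnergy 0 0 L := by
    unfold periodicGroundStateEnergy
    exact iInf_congr fun Ψ => periodicEnergy_zero_particles v Ψ
  rw [h, periodicGroundStateEnergy_zero_eq_zero 0 hL]

/-- **Zero-momentum gap at fixed `(N, L)` from a bounded periodisation**: for measurable `v` with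
`v^per ≤ C` on the torus of side `L > 0`, `E₀^per(N,L) < E^per_N(q;L)` for every `q ≠ 0` and every
`N` (`N ≥ 1`: nondegeneracy `PeriodicGroundStateNondegenerate_holds` and §2; `N = 0`: empty sector).
[cite: ReedSimonIV1978, §XIII.12 Thms XIII.43–XIII.47] -/
theorem zeroMomentumGap_of_periodizedPotential_le {v : ℝ → ℝ≥0∞} (hv : Measurable v) (N : ℕ)
    (hL : 0 < L) (hC : ∃ C : NNReal, ∀ x, periodizedPotential v L x ≤ C) {q : Space} (hq : q ≠ 0) :
    periodicGroundStateEnergy v N L < momentumSectorEnergy v N L q := by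
  rcases Nat.eq_zero_or_pos N with rfl | hN
  · rw [momentumSectorEnergy_zero_particles v L hq, periodicGroundStateEnergy_zero_particles v hL]
    exact ENNReal.zero_lt_top
  · exact zeroMomentumGap_of_two_mul_lt_kyFanTwo hL
      (PeriodicGroundStateNondegenerate_holds N L v hN hL hv hC) hq

/-- **Stub 3a of the line — the zero-momentum gap for BOUNDED admissible potentials** (the bounded
half of stmt-AtomisticToContinuum-11845, in the skeleton's vocabulary `ZeroMomentumGapFor`): for every
repulsive finite-range `v` with `v ≤ M < ⊤`, every `N`, every `L > 0` and every `q ≠ 0`,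
`E₀^per(N,L) < E^per_N(q;L)`. [cite: ReedSimonIV1978, §XIII.12 Thms XIII.43–XIII.47] -/
theorem zeroMomentumGapFor_of_bounded {v : ℝ → ℝ≥0∞} (hv : IsRepulsiveFiniteRange v)
    (hM : ∃ M : ℝ≥0∞, M ≠ ⊤ ∧ ∀ r, v r ≤ M) : ZeroMomentumGapFor v :=
  fun N _ hL _ hq =>
    zeroMomentumGap_of_periodizedPotential_le hv.1 N hL (exists_periodizedPotential_le hv hM hL) hq

/-- **Registered stub `stub_zeroMomentumGroundBounded` of the crux skeleton** (stub 3a of line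
`linear-ph-floor-wagner`, `ledger skeleton check` v6), verbatim signature.
[cite: ReedSimonIV1978, §XIII.12 Thms XIII.43–XIII.47] -/
theorem stub_zeroMomentumGroundBounded :
    ∀ v : ℝ → ℝ≥0∞, IsRepulsiveFiniteRange v → (∃ M : ℝ≥0∞, M ≠ ⊤ ∧ ∀ r, v r ≤ M) →
      ZeroMomentumGapFor v :=
  fun _ hv hM => zeroMomentumGapFor_of_bounded hv hM

/-- The same, in the verbatim shape of stmt-AtomisticToContinuum-11845 restricted to bounded potentials
(`BECNoCheapMomentum.ZeroMomentumGround` with the extra hypothesis `v ≤ M < ⊤`; the integrability guard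
is then automatic and is kept only to match the item). [cite: ReedSimonIV1978, §XIII.12 Thms XIII.43–XIII.47] -/
theorem zeroMomentumGround_of_bounded :
    ∀ v : ℝ → ℝ≥0∞, IsRepulsiveFiniteRange v → (∃ M : ℝ≥0∞, M ≠ ⊤ ∧ ∀ r, v r ≤ M) →
      (∫⁻ x : Space, v ‖x‖) ≠ ⊤ → ∀ (N : ℕ) (L : ℝ), 0 < L → ∀ q : Space, q ≠ 0 →
        periodicGroundStateEnergy v N L <
          ⨅ (Ψ : PeriodicTrialState N L) (_ : ∀ (s : Space) (X : Config N),
            Ψ.ψ (fun i => X i + s) = Complex.exp (Complex.I * ↑(∑ j, q j * s j)) * Ψ.ψ X),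
            periodicEnergy v Ψ :=
  fun _ hv hM _ N L hL q hq => zeroMomentumGapFor_of_bounded hv hM N L hL q hq

end Summit.AtomisticToContinuum.BoseEinsteinCondensation.Cruxes.PeriodicIRBound.LinearPhFloorWagner

end
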